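import Summits.QuantumFields.YangMills.Theorems.FradkinShenkerFlowClusteringToYangMillsStubCylinderApprox
import Summits.QuantumFields.YangMills.Theorems.FradkinShenkerFlowClusteringToYangMillsStubReconstructibleGeometry
import HarnessLib

/-!
# `stub_admissibleGivesGap`, helper 2/4: reflection positivity of the odd torus for lifted
# positive-time observables, and its passage to odd-torus limit states on continuous cylinders

Support file for crux `stmt-QuantumFields-8762`
(`Summit.QuantumFields.YangMills.Theses.EquipartitionCriticality.CriticalContinuumLimit`), line
`Sketch`, stub `stub_admissibleGivesGap` (I0 = RQ of line `spectral-requantisation-dock` of crux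
`ClusteringToYangMills`, stmt-QuantumFields-9443): torus clustering at `β` with rate `m` ⟹ every
odd-torus limit state is OS-reconstructible with transfer gap `≥ m`. The stub is assembled in
`EquipartitionCriticalityCriticalContinuumLimitStubAdmissibleGivesGap.lean` from four helper files
(`…LTwo`, `…TorusRP`, `…Gauge`, `…GaugeInvariance`) and the landed RQ0/RQb2 of 9443.

**This file.** On the odd torus of side `2S+1`, Wave 0's reflection `Θ_T` (`t ↦ 1 - t`) is
reflection positive on observables of the closed half `1 ≤ t ≤ S (+1)`
(`wilsonExpectation_oddReflectionPositive`), hence also on observables of the reflected half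
(`oddRP_reflected`, by `Θ_T`-invariance of the Wilson state). The periodic lift intertwines
`Θ ∘ lift = lift ∘ T_{-2e₀} ∘ Θ_T`, `τ ∘ lift = lift ∘ T_{-e₀}` (`stub_reconstructible_geometry`);
after a translation by `e₀` (bond plane) resp. by `(S-1) e₀` (the site plane `x₀ = 0` of `ℤ⁴`
becomes the antipodal site plane of the torus), `Re ∫ F̄(Θ lift V) F(lift V) ≥ 0` and
`Re ∫ F̄(Θ lift V) F(τ lift V) ≥ 0` for every bounded measurable cylinder `F` of `ℤ⁴` supported on
links based at times `0 ≤ x₀ ≤ S - 2` (`torus_rp_bond`, `torus_rp_site`). For a bounded continuous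
cylinder `F` the real parts of the two OS integrands are bounded continuous cylinder observables, so
both positivity statements pass to every odd-torus limit state (`re_osForm_nonneg_of_continuous`,
registered as `admissibleGap_rpOfContinuous`).

References: K. Osterwalder, E. Seiler, Ann. Phys. 110 (1978) 440, §2; E. Seiler, LNP 159 (1982)
Ch. 2; J. Glimm, A. Jaffe, *Quantum Physics* (1987) §6.1; J. Fröhlich, R. Israel, E. Lieb,
B. Simon, Comm. Math. Phys. 62 (1978) 1, §2–3.
-/

noncomputable section

open scoped BigOperators Topology ENNReal ComplexConjugate ComplexOrder
open MeasureTheory Filter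
open Literature.MathematicalPhysics Literature.MathematicalPhysics.QuantumFieldTheory
  Literature.MathematicalPhysics.QuantumLattice
open Literature.Probability.LatticeModels (IsOSReconstructible IsBoundedMeasurable positiveEvents osForm)

namespace Summit.QuantumFields.YangMills.Theorems.CriticalContinuumLimit.AdmissibleGap

open Summit.QuantumFields.YangMills.Theorems.ClusteringToYangMills
open Summit.QuantumFields.YangMills.Theorems.ClusteringToYangMills.Reconstructible

/-! ### Cylinder observables on `ℤ⁴`: time bounds of positive-time supports -/

section TimeBounds

/-- The largest time coordinate of the base points of a finite set of links (as a natural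
number; meaningful for positive-time links). [folklore] -/
def maxTime (Λ : Finset (QuantumLattice.ZdEdge 4)) : ℕ := Λ.sup fun e => (e.1 0).toNat

/-- A positive-time link of `Λ` is based at a time `0 ≤ x₀ ≤ maxTime Λ`: there is `n : ℕ` with
`x₀ = n ≤ maxTime Λ`. [folklore] -/
theorem exists_nat_time_of_mem {Λ : Finset (QuantumLattice.ZdEdge 4)} (hΛ : (↑Λ : Set (QuantumLattice.ZdEdge 4)) ⊆ posTimeEdges)
    {e : QuantumLattice.ZdEdge 4} (he : e ∈ Λ) : ∃ n : ℕ, e.1 0 = n ∧ n ≤ maxTime Λ := by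
  have h0 : 0 ≤ e.1 0 := hΛ (Finset.mem_coe.2 he)
  refine ⟨(e.1 0).toNat, (Int.toNat_of_nonneg h0).symm, ?_⟩
  exact Finset.le_sup (f := fun e : QuantumLattice.ZdEdge 4 => (e.1 0).toNat) he

end TimeBounds

/-! ### The torus layer: reflection positivity for lifted positive-time observables -/

section Torus

variable {G : Type} [Group G] [TopologicalSpace G] [IsTopologicalGroup G] [CompactSpace G]
  [MeasurableSpace G] [BorelSpace G] {N : ℕ} (ρ : G →* Matrix (Fin N) (Fin N) ℂ)

/-- `2S + 1 ≡ 0` in `ZMod (2S+1)`, in the form `2·S + 1 = 0`. [folklore] -/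
theorem two_mul_S_add_one (S : ℕ) : (2 : ZMod (2 * S + 1)) * (S : ZMod (2 * S + 1)) + 1 = 0 := by
  have h := ZMod.natCast_self (2 * S + 1)
  push_cast at h
  exact h

omit [Group G] [TopologicalSpace G] [IsTopologicalGroup G] [CompactSpace G] [BorelSpace G] in
/-- The time coordinate of the torus link read by a lifted, translated observable. [folklore] -/
theorem torusLift_torusConfigShift_apply {L : ℕ} (c : ZMod L) (V : GaugeConfig 4 L G) (e : QuantumLattice.ZdEdge 4) :
    torusLift L (torusConfigShift (Pi.single 0 c) V) e =
      V (Literature.Probability.LatticeModels.Torus.proj L e.1 - Pi.single 0 c, e.2) := by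
  simp only [torusLift, Function.comp_apply, torusEdge, torusConfigShift_apply]

/-- **Reflection positivity for the reflected half of the odd torus**: if `F'` depends only on
links whose `Θ_T`-reflection lies in the closed positive half, then `⟨F̄'∘Θ_T · F'⟩ ≥ 0`
(from `wilsonExpectation_oddReflectionPositive` for `F' ∘ Θ_T` and `Θ_T`-invariance of the Wilson
state). [folklore] -/
theorem oddRP_reflected {L : ℕ} [NeZero L] (hL : Odd L) (hL3 : 3 ≤ L) (hρ : Continuous ρ) {β : ℝ}
    (hβ : 0 ≤ β) (F' : GaugeConfig 4 L G → ℂ) (hF : Measurable F') (hFb : ∃ C : ℝ, ∀ U, ‖F' U‖ ≤ C)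
    (hFdep : DependsOn F' {e : Edge 4 L | WilsonOddRP.IsOPosEdge (WilsonRP.edgeReflect e) ∨
      WilsonOddRP.IsOSharedEdge (WilsonRP.edgeReflect e)}) :
    0 ≤ wilsonExpectation ρ β fun U => conj (F' U.timeReflect) * F' U := by
  obtain ⟨C, hC⟩ := hFb
  set F'' : GaugeConfig 4 L G → ℂ := fun U => F' U.timeReflect with hF''
  have hF''m : Measurable F'' := hF.comp WilsonRP.measurable_timeReflect
  have hF''dep : DependsOn F'' ((WilsonOddRP.oPosEdges ∪ WilsonOddRP.oSharedEdges :
      Finset (Edge 4 L)) : Set (Edge 4 L)) := by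
    intro U V hUV
    refine hFdep fun e he => ?_
    have hmem : WilsonRP.edgeReflect e ∈ ((WilsonOddRP.oPosEdges ∪ WilsonOddRP.oSharedEdges :
        Finset (Edge 4 L)) : Set (Edge 4 L)) := by
      simp only [Finset.coe_union, Set.mem_union, Finset.mem_coe, WilsonOddRP.mem_oPosEdges,
        WilsonOddRP.mem_oSharedEdges]
      exact he
    have := hUV _ hmem
    rw [WilsonRP.timeReflect_apply, WilsonRP.timeReflect_apply, this]
  have h := wilsonExpectation_oddReflectionPositive (d := 4) (L := L) ρ hL hL3 hρ hβ F'' hF''m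
    ⟨C, fun U => hC _⟩ hF''dep
  have e1 : (fun U : GaugeConfig 4 L G => conj (F'' U.timeReflect) * F'' U) =
      fun U => conj (F' U) * F' U.timeReflect := by
    funext U
    simp only [hF'', timeReflect_timeReflect_config]
  have e2 : (fun U : GaugeConfig 4 L G => conj (F' U.timeReflect) * F' U) =
      (fun U => conj (F' U) * F' U.timeReflect) ∘ GaugeConfig.timeReflect := by
    funext U
    simp only [Function.comp_apply, timeReflect_timeReflect_config]
  rw [e2, wilsonExpectation_comp_timeReflect ρ hρ, ← e1]
  exact h

variable {S : ℕ}

/-- Odd torus sides are never zero. [folklore] -/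
instance instNeZeroOddSide' (S : ℕ) : NeZero (2 * S + 1) := ⟨Nat.succ_ne_zero _⟩

omit [Group G] [TopologicalSpace G] [IsTopologicalGroup G] [CompactSpace G] [BorelSpace G] in
/-- **Bond plane.** A cylinder observable supported on links based at times `0 ≤ x₀ ≤ S - 1`,
lifted to the torus of side `2S+1` and translated by one unit, depends only on the closed
positive half of the odd torus. [folklore] -/
theorem dependsOn_lift_shift_one {α : Type*} {F : LGConfig 4 G → α} {Λ : Finset (QuantumLattice.ZdEdge 4)}
    (hF : IsCylinder F Λ) (hΛ : (↑Λ : Set (QuantumLattice.ZdEdge 4)) ⊆ posTimeEdges) (hS : maxTime Λ + 1 ≤ S) :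
    DependsOn (fun V : GaugeConfig 4 (2 * S + 1) G =>
        F (torusLift (2 * S + 1) (torusConfigShift (Pi.single 0 (-1)) V)))
      ((WilsonOddRP.oPosEdges ∪ WilsonOddRP.oSharedEdges : Finset (Edge 4 (2 * S + 1))) :
        Set (Edge 4 (2 * S + 1))) := by
  intro U V hUV
  refine hF fun e he => ?_
  rw [torusLift_torusConfigShift_apply, torusLift_torusConfigShift_apply]
  refine hUV _ ?_
  obtain ⟨n, hn, hnT⟩ := exists_nat_time_of_mem hΛ (Finset.mem_coe.1 he)
  have hval : ((Literature.Probability.LatticeModels.Torus.proj (2 * S + 1) e.1 -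
      Pi.single (0 : Fin 4) (-1 : ZMod (2 * S + 1)) : Site 4 (2 * S + 1)) 0).val = n + 1 := by
    simp only [Pi.sub_apply, Literature.Probability.LatticeModels.Torus.proj_apply, hn,
      Int.cast_natCast, Pi.single_eq_same, sub_neg_eq_add]
    rw [← Nat.cast_succ, ZMod.val_natCast_of_lt (by omega)]
  simp only [Finset.coe_union, Set.mem_union, Finset.mem_coe, WilsonOddRP.mem_oPosEdges,
    WilsonOddRP.mem_oSharedEdges, WilsonOddRP.IsOPosEdge]
  left
  rw [hval]
  omega

omit [Group G] [TopologicalSpace G] [IsTopologicalGroup G] [CompactSpace G] [BorelSpace G] in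
/-- **Site plane.** A cylinder observable supported on links based at times `0 ≤ x₀ ≤ S - 2`,
lifted to the torus of side `2S+1` and translated by `-(S-1)` units, depends only on links whose
`Θ_T`-reflections lie in the closed positive half. [folklore] -/
theorem dependsOn_lift_shift_S {α : Type*} {F : LGConfig 4 G → α} {Λ : Finset (QuantumLattice.ZdEdge 4)}
    (hF : IsCylinder F Λ) (hΛ : (↑Λ : Set (QuantumLattice.ZdEdge 4)) ⊆ posTimeEdges) (hS : maxTime Λ + 2 ≤ S) :
    DependsOn (fun V : GaugeConfig 4 (2 * S + 1) G =>
        F (torusLift (2 * S + 1) (torusConfigShift (Pi.single 0 ((S : ZMod (2 * S + 1)) - 1)) V)))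
      {e : Edge 4 (2 * S + 1) | WilsonOddRP.IsOPosEdge (WilsonRP.edgeReflect e) ∨
        WilsonOddRP.IsOSharedEdge (WilsonRP.edgeReflect e)} := by
  intro U V hUV
  refine hF fun e he => ?_
  rw [torusLift_torusConfigShift_apply, torusLift_torusConfigShift_apply]
  refine hUV _ ?_
  obtain ⟨n, hn, hnT⟩ := exists_nat_time_of_mem hΛ (Finset.mem_coe.1 he)
  set y : Site 4 (2 * S + 1) := Literature.Probability.LatticeModels.Torus.proj (2 * S + 1) e.1 -
    Pi.single 0 ((S : ZMod (2 * S + 1)) - 1) with hy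
  have hy0 : y 0 = (n : ZMod (2 * S + 1)) - ((S : ZMod (2 * S + 1)) - 1) := by
    simp only [hy, Pi.sub_apply, Literature.Probability.LatticeModels.Torus.proj_apply, hn,
      Int.cast_natCast, Pi.single_eq_same]
  simp only [Set.mem_setOf_eq, WilsonOddRP.IsOPosEdge]
  left
  unfold WilsonRP.edgeReflect
  by_cases hi : e.2 = 0
  · simp only [hi, ↓reduceIte]
    have ht : (Site.shift y 0).timeReflect 0 = ((S - 1 - n : ℕ) : ZMod (2 * S + 1)) := by
      rw [WilsonRP.timeReflect_apply_zero, WilsonRP.shift_apply_self, hy0,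
        Nat.cast_sub (by omega), Nat.cast_sub (by omega)]
      push_cast
      ring
    rw [ht, ZMod.val_natCast_of_lt (by omega)]
    omega
  · simp only [hi, ↓reduceIte]
    have ht : y.timeReflect 0 = ((S - n : ℕ) : ZMod (2 * S + 1)) := by
      rw [WilsonRP.timeReflect_apply_zero, hy0, Nat.cast_sub (by omega)]
      ring
    rw [ht, ZMod.val_natCast_of_lt (by omega)]
    omega

/-- **Bond-plane reflection positivity for lifted observables.** For a bounded measurable
cylinder observable `F` of `ℤ⁴` supported on links based at times `0 ≤ x₀ ≤ S - 1` (`S ≥ 1`),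
`β ≥ 0`: `Re ∫ F̄(Θ lift V) F(lift V) dμ_{2S+1,β}(V) ≥ 0`. [folklore] -/
theorem torus_rp_bond (hρ : Continuous ρ) {β : ℝ} (hβ : 0 ≤ β) (hS1 : 1 ≤ S)
    {F : LGConfig 4 G → ℂ} (hFm : Measurable F) (hFb : ∃ C : ℝ, ∀ U, ‖F U‖ ≤ C)
    {Λ : Finset (QuantumLattice.ZdEdge 4)} (hF : IsCylinder F Λ) (hΛ : (↑Λ : Set (QuantumLattice.ZdEdge 4)) ⊆ posTimeEdges)
    (hS : maxTime Λ + 1 ≤ S) :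
    0 ≤ (∫ V, conj (F (gaugeTimeReflect (torusLift (2 * S + 1) V))) * F (torusLift (2 * S + 1) V)
      ∂(wilsonMeasure (d := 4) (L := 2 * S + 1) ρ β)).re := by
  obtain ⟨C, hC⟩ := hFb
  set F' : GaugeConfig 4 (2 * S + 1) G → ℂ := fun W =>
    F (torusLift (2 * S + 1) (torusConfigShift (Pi.single 0 (-1)) W)) with hF'
  have hF'm : Measurable F' :=
    hFm.comp ((measurable_torusLift _).comp (torusConfigShift _).measurable)
  have hkey : (fun V : GaugeConfig 4 (2 * S + 1) G =>
      conj (F (gaugeTimeReflect (torusLift (2 * S + 1) V))) * F (torusLift (2 * S + 1) V)) =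
      (fun W => conj (F' W.timeReflect) * F' W) ∘ torusConfigShift (Pi.single 0 1) := by
    funext V
    simp only [Function.comp_apply, hF', gaugeTimeReflect_torusLift,
      timeReflect_torusConfigShift_single, torusConfigShift_torusConfigShift, ← Pi.single_add]
    norm_num [torusConfigShift_zero]
  have hpos := wilsonExpectation_oddReflectionPositive (d := 4) (L := 2 * S + 1) ρ ⟨S, by ring⟩
    (by omega) hρ hβ F' hF'm ⟨C, fun U => hC _⟩ (dependsOn_lift_shift_one hF hΛ hS)
  have hexp : (∫ V, conj (F (gaugeTimeReflect (torusLift (2 * S + 1) V))) *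
      F (torusLift (2 * S + 1) V) ∂(wilsonMeasure (d := 4) (L := 2 * S + 1) ρ β)) =
      wilsonExpectation ρ β fun W : GaugeConfig 4 (2 * S + 1) G => conj (F' W.timeReflect) * F' W := by
    rw [← wilsonExpectation_comp_torusConfigShift ρ β (Pi.single 0 1), ← hkey]
    rfl
  rw [hexp]
  exact (Complex.nonneg_iff.1 hpos).1

/-- **Site-plane reflection positivity for lifted observables** (RP half a step up).  For a
bounded measurable cylinder observable `F` of `ℤ⁴` supported on links based at times
`0 ≤ x₀ ≤ S - 2`, `β ≥ 0`: `Re ∫ F̄(Θ lift V) F(τ lift V) dμ_{2S+1,β}(V) ≥ 0` — on the torus this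
is positivity for the antipodal site plane of `Θ_T`. [folklore] -/
theorem torus_rp_site (hρ : Continuous ρ) {β : ℝ} (hβ : 0 ≤ β)
    {F : LGConfig 4 G → ℂ} (hFm : Measurable F) (hFb : ∃ C : ℝ, ∀ U, ‖F U‖ ≤ C)
    {Λ : Finset (QuantumLattice.ZdEdge 4)} (hF : IsCylinder F Λ) (hΛ : (↑Λ : Set (QuantumLattice.ZdEdge 4)) ⊆ posTimeEdges)
    (hS : maxTime Λ + 2 ≤ S) :
    0 ≤ (∫ V, conj (F (gaugeTimeReflect (torusLift (2 * S + 1) V))) *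
        F (gaugeTimeShift (torusLift (2 * S + 1) V))
      ∂(wilsonMeasure (d := 4) (L := 2 * S + 1) ρ β)).re := by
  obtain ⟨C, hC⟩ := hFb
  have hL0 := two_mul_S_add_one S
  set F' : GaugeConfig 4 (2 * S + 1) G → ℂ := fun W =>
    F (torusLift (2 * S + 1) (torusConfigShift (Pi.single 0 ((S : ZMod (2 * S + 1)) - 1)) W))
    with hF'
  have hF'm : Measurable F' :=
    hFm.comp ((measurable_torusLift _).comp (torusConfigShift _).measurable)
  have h1 : (S : ZMod (2 * S + 1)) - 1 + S = -2 := by linear_combination hL0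
  have h2 : (S : ZMod (2 * S + 1)) - 1 + -S = -1 := by ring
  have hkey : (fun V : GaugeConfig 4 (2 * S + 1) G =>
      conj (F (gaugeTimeReflect (torusLift (2 * S + 1) V))) *
        F (gaugeTimeShift (torusLift (2 * S + 1) V))) =
      (fun W => conj (F' W.timeReflect) * F' W) ∘ torusConfigShift (Pi.single 0 (-(S : ZMod (2 * S + 1)))) := by
    funext V
    simp only [Function.comp_apply, hF', gaugeTimeReflect_torusLift, gaugeTimeShift_torusLift,
      timeReflect_torusConfigShift_single, torusConfigShift_torusConfigShift, ← Pi.single_add,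
      neg_neg, h1, h2]
  have hpos := oddRP_reflected ρ ⟨S, by ring⟩ (by omega) hρ hβ F' hF'm ⟨C, fun U => hC _⟩
    (dependsOn_lift_shift_S hF hΛ hS)
  have hexp : (∫ V, conj (F (gaugeTimeReflect (torusLift (2 * S + 1) V))) *
      F (gaugeTimeShift (torusLift (2 * S + 1) V)) ∂(wilsonMeasure (d := 4) (L := 2 * S + 1) ρ β)) =
      wilsonExpectation ρ β fun W : GaugeConfig 4 (2 * S + 1) G => conj (F' W.timeReflect) * F' W := by
    rw [← wilsonExpectation_comp_torusConfigShift ρ β (Pi.single 0 (-(S : ZMod (2 * S + 1)))), ← hkey]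
    rfl
  rw [hexp]
  exact (Complex.nonneg_iff.1 hpos).1

end Torus

/-! ### Odd-torus limit states: invariances and reflection positivity on continuous cylinders -/

section Limit

variable {G : Type} [Group G] [TopologicalSpace G] [IsTopologicalGroup G] [CompactSpace G]
  [MeasurableSpace G] [BorelSpace G]

omit [Group G] [TopologicalSpace G] [IsTopologicalGroup G] [CompactSpace G] [MeasurableSpace G]
  [BorelSpace G] in
/-- Binary combinations of cylinder observables are cylinder observables. [folklore] -/
private theorem isCylinder_map₂ {α β γ : Type*} (H : α → β → γ) {F₁ : LGConfig 4 G → α}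
    {F₂ : LGConfig 4 G → β} {Λ₁ Λ₂ : Finset (QuantumLattice.ZdEdge 4)} (h₁ : IsCylinder F₁ Λ₁)
    (h₂ : IsCylinder F₂ Λ₂) : IsCylinder (fun U => H (F₁ U) (F₂ U)) (Λ₁ ∪ Λ₂) := by
  intro U V hUV
  have e₁ : F₁ U = F₁ V := h₁ fun e he => hUV e (by rw [Finset.coe_union]; exact Or.inl he)
  have e₂ : F₂ U = F₂ V := h₂ fun e he => hUV e (by rw [Finset.coe_union]; exact Or.inr he)
  simp only [e₁, e₂]

variable (r : LatticeRep G) {β : ℝ} {μ : Measure (LGConfig 4 G)}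

/-- **Reflection positivity of odd-torus limit states on continuous cylinder observables**, for
the bond reflection `Θ` (`σ = id`) and half a step up (`σ = τ`): for a bounded continuous
measurable cylinder `F` supported on positive-time links, `0 ≤ Re ∫ F̄∘Θ · F dμ` and
`0 ≤ Re ∫ F̄∘Θ · F∘τ dμ`. [folklore] -/
theorem re_osForm_nonneg_of_continuous [IsProbabilityMeasure μ] (hβ : 0 ≤ β)
    (hμ : μ ∈ oddTorusLimitPoints r β) {F : LGConfig 4 G → ℂ} (hFc : Continuous F)
    (hFm : Measurable F) (hFb : ∃ C : ℝ, ∀ U, ‖F U‖ ≤ C) {Λ : Finset (QuantumLattice.ZdEdge 4)}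
    (hF : IsCylinder F Λ) (hΛ : (↑Λ : Set (QuantumLattice.ZdEdge 4)) ⊆ posTimeEdges) :
    0 ≤ (∫ U, conj (F (gaugeTimeReflect U)) * F U ∂μ).re ∧
      0 ≤ (∫ U, conj (F (gaugeTimeReflect U)) * F (gaugeTimeShift U) ∂μ).re := by
  obtain ⟨C, hC⟩ := hFb
  obtain ⟨S, hS, -, hlim⟩ := hμ
  -- the two real integrands, for `σ = id` and `σ = τ`
  have main : ∀ (σ : LGConfig 4 G → LGConfig 4 G), Continuous σ → Measurable σ →
      (∃ Λσ : Finset (QuantumLattice.ZdEdge 4), IsCylinder (F ∘ σ) Λσ) →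
      (∀ᶠ k in atTop, 0 ≤ (∫ V, conj (F (gaugeTimeReflect (torusLift (2 * S k + 1) V))) *
          F (σ (torusLift (2 * S k + 1) V)) ∂(wilsonMeasure (d := 4) (L := 2 * S k + 1) r.ρ β)).re) →
      0 ≤ (∫ U, conj (F (gaugeTimeReflect U)) * F (σ U) ∂μ).re := by
    intro σ hσc hσm ⟨Λσ, hΛσ⟩ hev
    set Φ : LGConfig 4 G → ℝ := fun U => (conj (F (gaugeTimeReflect U)) * F (σ U)).re with hΦ
    have hΦcyl : IsCylinder Φ _ := isCylinder_map₂ (fun a b : ℂ => (conj a * b).re)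
      (isCylinder_comp_gaugeTimeReflect hF) hΛσ
    have hΦc : Continuous Φ := Complex.continuous_re.comp
      ((Complex.continuous_conj.comp (hFc.comp continuous_gaugeTimeReflect)).mul (hFc.comp hσc))
    have hΦb : ∃ C', ∀ U, |Φ U| ≤ C' := ⟨C * C, fun U => by
      refine (Complex.abs_re_le_norm _).trans ?_
      rw [norm_mul, Complex.norm_conj]
      exact mul_le_mul (hC _) (hC _) (norm_nonneg _) ((norm_nonneg (F U)).trans (hC U))⟩
    have hint : ∀ (ν : Measure (LGConfig 4 G)) [IsFiniteMeasure ν],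
        Integrable (fun U => conj (F (gaugeTimeReflect U)) * F (σ U)) ν := by
      intro ν _
      refine Integrable.of_bound (((Complex.continuous_conj.measurable.comp
        (hFm.comp measurable_gaugeTimeReflect)).mul (hFm.comp hσm)).aestronglyMeasurable) (C * C)
        (ae_of_all _ fun U => ?_)
      rw [norm_mul, Complex.norm_conj]
      exact mul_le_mul (hC _) (hC _) (norm_nonneg _) ((norm_nonneg (F U)).trans (hC U))
    have t := hlim Φ _ hΦcyl hΦc hΦb
    have hre : (∫ U, conj (F (gaugeTimeReflect U)) * F (σ U) ∂μ).re = ∫ U, Φ U ∂μ := by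
      simp only [hΦ]
      exact (integral_re (hint μ)).symm
    rw [hre]
    refine ge_of_tendsto t (hev.mono fun k hk => ?_)
    haveI := isProbabilityMeasure_wilsonMeasure (d := 4) (L := 2 * S k + 1) r.ρ r.continuous β
    have hT : wilsonExpectation r.ρ β (toTorusObservable (2 * S k + 1) Φ) =
        (∫ V, conj (F (gaugeTimeReflect (torusLift (2 * S k + 1) V))) *
          F (σ (torusLift (2 * S k + 1) V)) ∂(wilsonMeasure (d := 4) (L := 2 * S k + 1) r.ρ β)).re := by
      simp only [wilsonExpectation, toTorusObservable, Function.comp_apply, hΦ]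
      have hi : Integrable (fun V : GaugeConfig 4 (2 * S k + 1) G =>
          conj (F (gaugeTimeReflect (torusLift (2 * S k + 1) V))) * F (σ (torusLift (2 * S k + 1) V)))
          (wilsonMeasure (d := 4) (L := 2 * S k + 1) r.ρ β) :=
        (hint ((wilsonMeasure (d := 4) (L := 2 * S k + 1) r.ρ β).map (torusLift (2 * S k + 1)))).comp_measurable
          (measurable_torusLift _)
      exact integral_re hi
    rw [hT]
    exact hk
  have hSk : ∀ T : ℕ, ∀ᶠ k in atTop, T ≤ S k :=
    fun T => (hS.tendsto_atTop.eventually (eventually_ge_atTop T))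
  refine ⟨main id continuous_id measurable_id ⟨Λ, hF⟩ ?_, main gaugeTimeShift continuous_gaugeTimeShift
    measurable_gaugeTimeShift ⟨_, isCylinder_comp_gaugeTimeShift hF⟩ ?_⟩
  · filter_upwards [hSk (maxTime Λ + 1)] with k hk
    exact torus_rp_bond r.ρ r.continuous hβ (by omega) hFm ⟨C, hC⟩ hF hΛ hk
  · filter_upwards [hSk (maxTime Λ + 2)] with k hk
    exact torus_rp_site r.ρ r.continuous hβ hFm ⟨C, hC⟩ hF hΛ hk

end Limit

end Summit.QuantumFields.YangMills.Theorems.CriticalContinuumLimit.AdmissibleGap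

namespace Summit.QuantumFields.YangMills.Theorems.CriticalContinuumLimit

/-- **Registered helper `admissibleGap_rpOfContinuous`** (stub `stub_admissibleGivesGap`, helper
2/4): reflection positivity, for the bond reflection `Θ` and half a step up, of every odd-torus
limit state on bounded continuous measurable cylinder observables supported on positive-time links.
[folklore] -/
theorem admissibleGap_rpOfContinuous (G : Type) [Group G] [TopologicalSpace G] [IsTopologicalGroup G]
    [CompactSpace G] [MeasurableSpace G] [BorelSpace G] (r : LatticeRep G) (β : ℝ) (hβ : 0 ≤ β)
    (μ : Measure (LGConfig 4 G)) [IsProbabilityMeasure μ] (hμ : μ ∈ oddTorusLimitPoints r β)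
    (F : LGConfig 4 G → ℂ) (hFc : Continuous F) (hFm : Measurable F) (hFb : ∃ C : ℝ, ∀ U, ‖F U‖ ≤ C)
    (Λ : Finset (Literature.MathematicalPhysics.QuantumLattice.ZdEdge 4)) (hF : IsCylinder F Λ)
    (hΛ : (↑Λ : Set (Literature.MathematicalPhysics.QuantumLattice.ZdEdge 4)) ⊆ posTimeEdges) :
    0 ≤ (∫ U, conj (F (gaugeTimeReflect U)) * F U ∂μ).re ∧
      0 ≤ (∫ U, conj (F (gaugeTimeReflect U)) * F (gaugeTimeShift U) ∂μ).re :=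
  AdmissibleGap.re_osForm_nonneg_of_continuous r hβ hμ hFc hFm hFb hF hΛ

end Summit.QuantumFields.YangMills.Theorems.CriticalContinuumLimit

end
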